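import Summits.CriticalPhenomena.Ising3DConformalLimit.Theorems.EnergyNotSigmaSquaredRungOneAdjacentMergingAssemblyAux
import HarnessLib

/-!
# Stub `stub_assembly` of the line `dominant-shell-concentration` for the crux `RungOneAdjacentMerging`
(item stmt-CriticalPhenomena-11262, route `EnergyNotSigmaSquared`)

We prove STUB 6 of `Theorems/EnergyNotSigmaSquaredRungOneAdjacentMergingDefs.lean`:
`TowardCells → WindowRegular → ShareHarvest → VarianceBound`, i.e. given the doubly-toward
Messager–Miracle-Solé cone cells (STUB 3), one-sided window regularity (STUB 4) and the share
harvest (STUBS 5a/5b), for every `η > 0` there is a radius `R` beyond which every `x ∈ ℤ³` carries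
infinite-volume second-moment weights `InfVolWeights η x`.

## The computation (Aizenman–Duminil-Copin 2021, §6.2, proof of Prop. 6.6 / display (6.5), run for
the two systems `0 → x`, `e₂ → x + e₂` with share-proportional weights)

Fix `0 < η ≤ 16` (larger `η` by monotonicity).  With `A` from the harvest, `C = C_A` from window
regularity and `c₀` from the cells put `τ = min(1/16, η/(8(C+1)))`, `M = 16/(c₀η)`, `k₀ = 4`; let
`𝒦` be the harvested family (windowed scales `k ≥ 4`, pairwise decay/index separated,
`Σ_𝒦 share ≥ M`), `R = 2^{sup 𝒦 + 4}`, and for `‖x‖ ≥ R` let `U_k` (`k ∈ 𝒦`) be the cells.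
Weights: `c(u) = Σ_k 1[u ∈ U_k]·share(k)/(#U_k · dens x u · dens x (u-e₂))`; the mean is
`S = Σ_𝒦 share` exactly.  For `u ∈ U_k`, `v ∈ U_ℓ` the summand of the second sum is
`(share k share ℓ/(#U_k #U_ℓ))·G(x)²·R·R'` with (cone inequalities of the cells)
`R ≤ G(v-u)/G(v) + G(u-v)/G(u)`, `R' ≤ G(v-u)/G(v-e₂) + G(u-v)/G(u-e₂)`.
* CROSS (`k ≠ ℓ`, say `k < ℓ`): `G(v-u) ≤ (1+Cτ)G(v)` and `G(v-u) ≤ (1+Cτ)G(v-e₂)` (window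
  regularity at the larger scale `ℓ`, `16‖u‖, 16‖u-e₂‖ ≤ 2^ℓ` by index separation),
  `G(u-v) ≤ g(2^{ℓ-2}) ≤ τ g(2^{k+2}) ≤ τ G(u), τ G(u-e₂)` (MMS + decay separation + cells); so
  `R R' ≤ (1+(C+1)τ)² ≤ 1 + η/2`, and the cross blocks sum to `≤ (1+η/2) G(x)² S²`.
* DIAGONAL (`k = ℓ`): `R, R' ≤ 2G(u-v)/g(2^{k+2})` (evenness + cells), and
  `Σ_{v ∈ U_k} G(u-v)² ≤ B(2^{k+1})` (injectivity of `v ↦ u-v` into `Λ_{2^{k+1}}`), so the block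
  is `≤ 4 share(k)² G(x)² B(2^{k+1})/(#U_k g(2^{k+2})²) ≤ (4/c₀) share(k) G(x)²`; summed,
  `≤ (4/c₀) S G(x)² ≤ (η/4) S² G(x)²` since `S ≥ 16/(c₀η)`.
Total `≤ (1 + 3η/4) G(x)² S² ≤ (1+η) G(x)² S²`.

The general helper lemmas (positivity, evenness, MMS, cone reduction, pair bound, sum bookkeeping,
cross ratios) are in `Theorems/EnergyNotSigmaSquaredRungOneAdjacentMergingAssemblyAux.lean`.
No named fact is used; nothing is defined.
-/

noncomputable section

open Finset
open scoped BigOperators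
open Literature.Probability.LatticeModels

namespace Summit.CriticalPhenomena.Ising3DConformalLimit.RungOneAdjacentMergingDominantShell

/-! ### The two block bounds -/

/-- CROSS BLOCK (`k ≠ ℓ`):
`Σ_{u ∈ U_k, v ∈ U_ℓ} c_k(u) c_ℓ(v) T T' ≤ share k · share ℓ · (1+η/2) G(x)²`. -/
theorem asm_cross_block {A C τ η : ℝ} {x : Site 3} {𝒦 : Finset ℕ} {V : ℕ → Finset (Site 3)}
    {g : ℕ → Site 3 → ℝ} (hC0 : 0 ≤ C) (hτ0 : 0 < τ) (hτ16 : τ ≤ 1 / 16)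
    (hτη : (C + 1) * τ ≤ η / 8) (hη16 : η ≤ 16)
    (hW : ∀ ℓ : ℕ, 4 ≤ ℓ → HasWindow A ℓ → ∀ v w : Site 3, (2 : ℝ) ^ (ℓ - 2) ≤ ‖v‖ →
      ‖v‖ ≤ (2 : ℝ) ^ (ℓ + 1) → 16 * ‖w‖ ≤ (2 : ℝ) ^ ℓ →
      Gc (v - w) ≤ (1 + C * ‖w‖ / 2 ^ ℓ) * Gc v)
    (h𝒦win : ∀ k ∈ 𝒦, 4 ≤ k ∧ HasWindow A k)
    (h𝒦sep : ∀ k ∈ 𝒦, ∀ ℓ ∈ 𝒦, k < ℓ →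
      axisG (2 ^ (ℓ - 2)) ≤ τ * axisG (2 ^ (k + 2)) ∧ (2 : ℝ) ^ (k + 1) ≤ τ * 2 ^ ℓ)
    (hVpos : ∀ k ∈ 𝒦, (0 : ℝ) < (V k).card)
    (hV : ∀ k ∈ 𝒦, ∀ u ∈ V k, (2 : ℝ) ^ (k - 1) ≤ ‖u‖ ∧ ‖u‖ ≤ (2 : ℝ) ^ k ∧
      Gc x ≤ Gc (x - u) ∧ Gc x ≤ Gc (x - (u - e₂)) ∧
      axisG (2 ^ (k + 2)) ≤ Gc u ∧ axisG (2 ^ (k + 2)) ≤ Gc (u - e₂))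
    (hg : ∀ k u, g k u = share k / ((V k).card * (dens x u * dens x (u - e₂))))
    {k ℓ : ℕ} (hk : k ∈ 𝒦) (hℓ : ℓ ∈ 𝒦) (hkl : k ≠ ℓ) :
    ∑ u ∈ V k, ∑ v ∈ V ℓ, g k u * g ℓ v * (tstep x u v * tstep x (u - e₂) (v - e₂)) ≤
      share k * share ℓ * ((1 + η / 2) * Gc x ^ 2) := by
  have hC1 : 0 < C + 1 := by linarith
  -- pointwise bound
  have hpt : ∀ u ∈ V k, ∀ v ∈ V ℓ,
      g k u * g ℓ v * (tstep x u v * tstep x (u - e₂) (v - e₂)) ≤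
        share k * share ℓ / ((V k).card * (V ℓ).card) * Gc x ^ 2 * (1 + η / 2) := by
    intro u hu v hv
    obtain ⟨hu1, hu2, hu3, hu4, hu5, hu6⟩ := hV k hk u hu
    obtain ⟨hv1, hv2, hv3, hv4, hv5, hv6⟩ := hV ℓ hℓ v hv
    have hXX' : Gc (v - u) / Gc v + Gc (u - v) / Gc u ≤ 1 + (C + 1) * τ ∧
        Gc (v - u) / Gc (v - e₂) + Gc (u - v) / Gc (u - e₂) ≤ 1 + (C + 1) * τ := by
      rcases lt_or_gt_of_ne hkl with hlt | hlt
      · obtain ⟨hsep, hidx⟩ := h𝒦sep k hk ℓ hℓ hlt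
        obtain ⟨r1, r2, r3, r4⟩ := asm_cross hC0 hτ0.le hτ16 hW (h𝒦win ℓ hℓ).1 (h𝒦win ℓ hℓ).2
          hsep hidx hu2 hv1 hv2 hu5 hu6
        exact ⟨(asm_ratio_add_le (asm_Gc_pos v) (asm_Gc_pos u) r1 r3).trans_eq (by ring),
          (asm_ratio_add_le (asm_Gc_pos _) (asm_Gc_pos _) r2 r4).trans_eq (by ring)⟩
      · obtain ⟨hsep, hidx⟩ := h𝒦sep ℓ hℓ k hk hlt
        obtain ⟨r1, r2, r3, r4⟩ := asm_cross hC0 hτ0.le hτ16 hW (h𝒦win k hk).1 (h𝒦win k hk).2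
          hsep hidx hv2 hu1 hu2 hv5 hv6
        exact ⟨(asm_ratio_add_le (asm_Gc_pos v) (asm_Gc_pos u) r3 r1).trans_eq (by ring),
          (asm_ratio_add_le (asm_Gc_pos _) (asm_Gc_pos _) r4 r2).trans_eq (by ring)⟩
    have hT := asm_tstep_le x u v hu3 hv3 _ hXX'.1
    have hT' := asm_tstep_le x (u - e₂) (v - e₂) hu4 hv4 (1 + (C + 1) * τ)
      (by rw [sub_sub_sub_cancel_right, sub_sub_sub_cancel_right]; exact hXX'.2)
    rw [hg, hg]
    exact asm_pair_le (asm_dens_pos x u) (asm_dens_pos x _) (asm_dens_pos x v) (asm_dens_pos x _)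
      (hVpos k hk) (hVpos ℓ hℓ) (share_nonneg k) (share_nonneg ℓ) (asm_tstep_nonneg x u v)
      (asm_tstep_nonneg x _ _) hT hT'
      (asm_sq_le (mul_nonneg hC1.le hτ0.le) hτη hη16)
  have hkne : ((V k).card : ℝ) ≠ 0 := (hVpos k hk).ne'
  have hℓne : ((V ℓ).card : ℝ) ≠ 0 := (hVpos ℓ hℓ).ne'
  calc ∑ u ∈ V k, ∑ v ∈ V ℓ, g k u * g ℓ v * (tstep x u v * tstep x (u - e₂) (v - e₂))
      ≤ ∑ u ∈ V k, ∑ v ∈ V ℓ,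
          share k * share ℓ / ((V k).card * (V ℓ).card) * Gc x ^ 2 * (1 + η / 2) :=
        Finset.sum_le_sum fun u hu => Finset.sum_le_sum fun v hv => hpt u hu v hv
    _ = share k * share ℓ * ((1 + η / 2) * Gc x ^ 2) := by
        rw [Finset.sum_const, Finset.sum_const, nsmul_eq_mul, nsmul_eq_mul]
        field_simp

/-- DIAGONAL BLOCK (`k = ℓ`): `Σ_{u, v ∈ U_k} c_k(u) c_k(v) T T' ≤ (4/c₀) G(x)² share k`
(evenness, the cells' lower bounds, bubble clumping `Σ_v G(u-v)² ≤ B(2^{k+1})`, `#U_k ≥ c₀ 8^k`). -/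
theorem asm_diag_block {c₀ : ℝ} {x : Site 3} {𝒦 : Finset ℕ} {V : ℕ → Finset (Site 3)}
    {g : ℕ → Site 3 → ℝ} (hc₀ : 0 < c₀)
    (hVcard : ∀ k ∈ 𝒦, c₀ * 8 ^ k ≤ ((V k).card : ℝ))
    (hV : ∀ k ∈ 𝒦, ∀ u ∈ V k, (2 : ℝ) ^ (k - 1) ≤ ‖u‖ ∧ ‖u‖ ≤ (2 : ℝ) ^ k ∧
      Gc x ≤ Gc (x - u) ∧ Gc x ≤ Gc (x - (u - e₂)) ∧
      axisG (2 ^ (k + 2)) ≤ Gc u ∧ axisG (2 ^ (k + 2)) ≤ Gc (u - e₂))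
    (hg : ∀ k u, g k u = share k / ((V k).card * (dens x u * dens x (u - e₂))))
    {k : ℕ} (hk : k ∈ 𝒦) :
    ∑ u ∈ V k, ∑ v ∈ V k, g k u * g k v * (tstep x u v * tstep x (u - e₂) (v - e₂)) ≤
      4 / c₀ * Gc x ^ 2 * share k := by
  have hα := asm_axisG_pos (2 ^ (k + 2))
  have hVpos : (0 : ℝ) < (V k).card :=
    (mul_pos hc₀ (pow_pos (by norm_num) k)).trans_le (hVcard k hk)
  -- pointwise bound
  have hpt : ∀ u ∈ V k, ∀ v ∈ V k,
      g k u * g k v * (tstep x u v * tstep x (u - e₂) (v - e₂)) ≤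
        share k * share k / ((V k).card * (V k).card) * Gc x ^ 2 *
          (4 / axisG (2 ^ (k + 2)) ^ 2) * Gc (u - v) ^ 2 := by
    intro u hu v hv
    obtain ⟨-, -, hu3, hu4, hu5, hu6⟩ := hV k hk u hu
    obtain ⟨-, -, hv3, hv4, hv5, hv6⟩ := hV k hk v hv
    have h0 := (asm_Gc_pos (u - v)).le
    have hX : Gc (v - u) / Gc v + Gc (u - v) / Gc u ≤ 2 * Gc (u - v) / axisG (2 ^ (k + 2)) := by
      rw [asm_Gc_sub_comm v u, mul_div_assoc]
      have h1 := div_le_div_of_nonneg_left h0 hα hv5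
      have h2 := div_le_div_of_nonneg_left h0 hα hu5
      linarith
    have hX' : Gc (v - e₂ - (u - e₂)) / Gc (v - e₂) + Gc (u - e₂ - (v - e₂)) / Gc (u - e₂) ≤
        2 * Gc (u - v) / axisG (2 ^ (k + 2)) := by
      rw [sub_sub_sub_cancel_right, sub_sub_sub_cancel_right, asm_Gc_sub_comm v u, mul_div_assoc]
      have h1 := div_le_div_of_nonneg_left h0 hα hv6
      have h2 := div_le_div_of_nonneg_left h0 hα hu6
      linarith
    have hT := asm_tstep_le x u v hu3 hv3 _ hX
    have hT' := asm_tstep_le x (u - e₂) (v - e₂) hu4 hv4 _ hX'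
    rw [hg, hg]
    refine (asm_pair_le (asm_dens_pos x u) (asm_dens_pos x _) (asm_dens_pos x v)
      (asm_dens_pos x _) hVpos hVpos (share_nonneg k) (share_nonneg k) (asm_tstep_nonneg x u v)
      (asm_tstep_nonneg x _ _) hT hT' le_rfl).trans_eq ?_
    ring
  -- the clumping sum
  have hrow : ∀ u ∈ V k, ∑ v ∈ V k, Gc (u - v) ^ 2 ≤ Bub (2 ^ (k + 1)) := fun u hu =>
    asm_sum_sq_le_Bub u (V k) fun v hv =>
      calc ‖u - v‖ ≤ ‖u‖ + ‖v‖ := norm_sub_le u v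
        _ ≤ 2 ^ k + 2 ^ k := add_le_add (hV k hk u hu).2.1 (hV k hk v hv).2.1
        _ = 2 ^ (k + 1) := by ring
  have hsk := share_nonneg k
  calc ∑ u ∈ V k, ∑ v ∈ V k, g k u * g k v * (tstep x u v * tstep x (u - e₂) (v - e₂))
      ≤ ∑ u ∈ V k, ∑ v ∈ V k, share k * share k / ((V k).card * (V k).card) * Gc x ^ 2 *
          (4 / axisG (2 ^ (k + 2)) ^ 2) * Gc (u - v) ^ 2 :=
        Finset.sum_le_sum fun u hu => Finset.sum_le_sum fun v hv => hpt u hu v hv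
    _ = share k * share k / ((V k).card * (V k).card) * Gc x ^ 2 *
          (4 / axisG (2 ^ (k + 2)) ^ 2) * ∑ u ∈ V k, ∑ v ∈ V k, Gc (u - v) ^ 2 := by
        rw [Finset.mul_sum]
        simp_rw [Finset.mul_sum]
    _ ≤ share k * share k / ((V k).card * (V k).card) * Gc x ^ 2 *
          (4 / axisG (2 ^ (k + 2)) ^ 2) * ((V k).card * Bub (2 ^ (k + 1))) := by
        refine mul_le_mul_of_nonneg_left ?_ (by positivity)
        calc ∑ u ∈ V k, ∑ v ∈ V k, Gc (u - v) ^ 2 ≤ ∑ _u ∈ V k, Bub (2 ^ (k + 1)) :=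
              Finset.sum_le_sum hrow
          _ = (V k).card * Bub (2 ^ (k + 1)) := by rw [Finset.sum_const, nsmul_eq_mul]
    _ ≤ 4 / c₀ * Gc x ^ 2 * share k :=
        asm_diag_const (E := 8 ^ k) rfl (asm_Bub_pos (by positivity)) hα hVpos hc₀
          (by positivity) (hVcard k hk)

/-! ### The stub -/

/-- STUB 6 (LOAD-BEARING COMPUTATION) — ASSEMBLY OF THE VARIANCE BOUND ("constant exactly 1"):
given cells, window-regularity and the harvest, for every `η > 0` there is `R` such that every `x` with
`‖x‖ ≥ R` carries infinite-volume weights at level `η`.  Route: WLOG `η ≤ 16`; `C = C_A` from STUB 4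
for the harvest's `A`; `τ = min(1/16, η/(8(C+1)))`, `M = 16/(c₀η)`, `k₀ = 4`; the family `𝒦` of the
harvest; `R = 2^{sup 𝒦 + 4}`; cells `U_k` (STUB 3) for `k ∈ 𝒦`; weights
`c(u) = Σ_k 1[u ∈ U_k] share(k)/(#U_k·dens x u·dens x (u-e₂))`, so the mean is `Σ_𝒦 share =: S`;
cross blocks `≤ share k share ℓ (1+η/2) G(x)²` (`asm_cross_block`), diagonal blocks
`≤ (4/c₀) share k G(x)²` (`asm_diag_block`); total `≤ (1+η/2) S² G(x)² + (4/c₀) S G(x)² ≤ (1+η) G(x)² S²`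
because `S ≥ 16/(c₀η)` (Aizenman–Duminil-Copin 2021, §6.2, (6.5)). -/
theorem stub_assembly : TowardCells → WindowRegular → ShareHarvest →
    ∀ η : ℝ, 0 < η → ∃ R : ℝ, ∀ x : Site 3, R ≤ ‖x‖ → InfVolWeights η x := by
  intro hcells hwin hharv
  -- reduction to `η ≤ 16`
  suffices main : ∀ η : ℝ, 0 < η → η ≤ 16 →
      ∃ R : ℝ, ∀ x : Site 3, R ≤ ‖x‖ → InfVolWeights η x by
    intro η hη
    obtain ⟨R, hR⟩ := main (min η 16) (lt_min hη (by norm_num)) (min_le_right _ _)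
    exact ⟨R, fun x hx => asm_infVolWeights_mono (min_le_left _ _) (hR x hx)⟩
  intro η hη hη16
  obtain ⟨c₀, hc₀, hcell⟩ := hcells
  obtain ⟨A, hA, hharv⟩ := hharv
  obtain ⟨C, hC0, hW⟩ := hwin A hA
  have hC1 : 0 < C + 1 := by linarith
  -- the separation parameter `τ`
  obtain ⟨τ, hτ0, hτ16, hτη⟩ : ∃ τ : ℝ, 0 < τ ∧ τ ≤ 1 / 16 ∧ (C + 1) * τ ≤ η / 8 := by
    refine ⟨min (1 / 16) (η / (8 * (C + 1))), lt_min (by norm_num) (by positivity),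
      min_le_left _ _, ?_⟩
    calc (C + 1) * min (1 / 16) (η / (8 * (C + 1))) ≤ (C + 1) * (η / (8 * (C + 1))) :=
          mul_le_mul_of_nonneg_left (min_le_right _ _) hC1.le
      _ = η / 8 := by
          field_simp
  -- the harvested family of scales
  obtain ⟨𝒦, h𝒦win, h𝒦sep, h𝒦sum⟩ := hharv τ hτ0 4 (16 / (c₀ * η))
  refine ⟨(2 : ℝ) ^ (𝒦.sup id + 4), fun x hx => ?_⟩
  -- the cells at the scales of `𝒦`
  have hfar : ∀ k ∈ 𝒦, (2 : ℝ) ^ (k + 4) ≤ ‖x‖ := fun k hk =>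
    (pow_le_pow_right₀ one_le_two (Nat.add_le_add_right (Finset.le_sup (f := id) hk) 4)).trans hx
  have hex : ∀ k, k ∈ 𝒦 → ∃ U : Finset (Site 3), c₀ * 8 ^ k ≤ (U.card : ℝ) ∧ ∀ u ∈ U,
      (2 : ℝ) ^ (k - 1) ≤ ‖u‖ ∧ ‖u‖ ≤ (2 : ℝ) ^ k ∧
      Gc x ≤ Gc (x - u) ∧ Gc x ≤ Gc (x - (u - e₂)) ∧
      axisG (2 ^ (k + 2)) ≤ Gc u ∧ axisG (2 ^ (k + 2)) ≤ Gc (u - e₂) :=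
    fun k hk => hcell k (h𝒦win k hk).1 x (hfar k hk)
  choose! V hVcard hV using hex
  have hVpos : ∀ k ∈ 𝒦, (0 : ℝ) < (V k).card := fun k hk =>
    (mul_pos hc₀ (pow_pos (by norm_num) k)).trans_le (hVcard k hk)
  have hsub : ∀ k ∈ 𝒦, V k ⊆ 𝒦.biUnion V := fun k hk => Finset.subset_biUnion_of_mem V hk
  -- total share `S ≥ 16/(c₀ η) > 0`
  obtain ⟨S, hS⟩ : ∃ S : ℝ, ∑ k ∈ 𝒦, share k = S := ⟨_, rfl⟩
  rw [hS] at h𝒦sum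
  have hS0 : 0 < S := (div_pos (by norm_num) (mul_pos hc₀ hη)).trans_le h𝒦sum
  -- the weights
  obtain ⟨g, hg⟩ : ∃ g : ℕ → Site 3 → ℝ,
      ∀ k u, g k u = share k / ((V k).card * (dens x u * dens x (u - e₂))) := ⟨_, fun _ _ => rfl⟩
  have hg0 : ∀ k u, 0 ≤ g k u := fun k u => by
    rw [hg]
    exact div_nonneg (share_nonneg k) (mul_nonneg (Nat.cast_nonneg _)
      (mul_nonneg (asm_dens_pos x u).le (asm_dens_pos x _).le))
  obtain ⟨c, hc⟩ : ∃ c : Site 3 → ℝ, ∀ u, c u = ∑ k ∈ 𝒦, if u ∈ V k then g k u else 0 :=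
    ⟨_, fun _ => rfl⟩
  -- MEAN: `Σ_u c(u) dens dens' = S`
  have hmean : ∑ u ∈ 𝒦.biUnion V, c u * (dens x u * dens x (u - e₂)) = S := by
    simp only [hc]
    rw [asm_sum_expand (𝒦.biUnion V) 𝒦 V hsub g, ← hS]
    refine Finset.sum_congr rfl fun k hk => ?_
    have hgu : ∀ u ∈ V k, g k u * (dens x u * dens x (u - e₂)) = share k / ((V k).card : ℝ) :=
      fun u _ => by
        rw [hg, div_mul_eq_mul_div,
          mul_div_mul_right _ _ (mul_pos (asm_dens_pos x u) (asm_dens_pos x _)).ne']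
    rw [Finset.sum_congr rfl hgu, Finset.sum_const, nsmul_eq_mul,
      mul_div_cancel₀ _ (hVpos k hk).ne']
  -- SECOND SUM: block expansion
  have hexp : ∑ u ∈ 𝒦.biUnion V, ∑ v ∈ 𝒦.biUnion V,
      c u * c v * (tstep x u v * tstep x (u - e₂) (v - e₂)) =
      ∑ k ∈ 𝒦, ∑ ℓ ∈ 𝒦, ∑ u ∈ V k, ∑ v ∈ V ℓ,
        g k u * g ℓ v * (tstep x u v * tstep x (u - e₂) (v - e₂)) := by
    simp only [hc]
    exact asm_sum_expand₂ (𝒦.biUnion V) 𝒦 V hsub g _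
  -- block bounds
  have hblock : ∀ k ∈ 𝒦, ∀ ℓ ∈ 𝒦,
      ∑ u ∈ V k, ∑ v ∈ V ℓ, g k u * g ℓ v * (tstep x u v * tstep x (u - e₂) (v - e₂)) ≤
        share k * share ℓ * ((1 + η / 2) * Gc x ^ 2) +
          if k = ℓ then 4 / c₀ * Gc x ^ 2 * share k else 0 := by
    intro k hk ℓ hℓ
    by_cases hkl : k = ℓ
    · subst hkl
      rw [if_pos rfl]
      have hsk := share_nonneg k
      exact le_add_of_nonneg_of_le (by positivity) (asm_diag_block hc₀ hVcard hV hg hk)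
    · rw [if_neg hkl, add_zero]
      exact asm_cross_block hC0 hτ0 hτ16 hτη hη16 hW h𝒦win h𝒦sep hVpos hV hg hk hℓ hkl
  refine ⟨𝒦.biUnion V, c, fun u => ?_, ?_, ?_⟩
  · rw [hc]
    exact Finset.sum_nonneg fun k _ => by
      split_ifs
      · exact hg0 k u
      · exact le_rfl
  · rw [hmean]
    exact hS0
  · rw [hmean, hexp]
    have hkey : 4 / c₀ * S ≤ η / 2 * S ^ 2 := by
      have h16 : 16 ≤ S * (c₀ * η) := (div_le_iff₀ (mul_pos hc₀ hη)).1 h𝒦sum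
      rw [div_mul_eq_mul_div, div_le_iff₀ hc₀]
      nlinarith [mul_le_mul_of_nonneg_left h16 (by positivity : (0 : ℝ) ≤ S / 2), hS0.le]
    have hG2 := mul_le_mul_of_nonneg_right hkey (sq_nonneg (Gc x))
    calc ∑ k ∈ 𝒦, ∑ ℓ ∈ 𝒦, ∑ u ∈ V k, ∑ v ∈ V ℓ,
          g k u * g ℓ v * (tstep x u v * tstep x (u - e₂) (v - e₂))
        ≤ ∑ k ∈ 𝒦, ∑ ℓ ∈ 𝒦, (share k * share ℓ * ((1 + η / 2) * Gc x ^ 2) +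
            if k = ℓ then 4 / c₀ * Gc x ^ 2 * share k else 0) :=
          Finset.sum_le_sum fun k hk => Finset.sum_le_sum fun ℓ hℓ => hblock k hk ℓ hℓ
      _ = S * S * ((1 + η / 2) * Gc x ^ 2) + 4 / c₀ * Gc x ^ 2 * S := by
          rw [asm_double_sum_eq, hS]
      _ ≤ (1 + η) * Gc x ^ 2 * S ^ 2 := by nlinarith [hG2]

end Summit.CriticalPhenomena.Ising3DConformalLimit.RungOneAdjacentMergingDominantShell

end
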